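import Literature.IUT.HodgeTheaters.GoodLocalFrobenioidOfGaloisCatIsomorphism
import Literature.IUT.HodgeTheaters.GoodLocalFrobenioidOfPlaceSlim
import HarnessLib

/-!
# [IUTchI] Example 3.3 (iii) (b) ON ISOMORPHISMS OF CATEGORIES: the induced homomorphisms (our §0 reading)
# `Aut(𝒞⊢_v) → Aut(𝒟⊢_v)`, `Aut(𝒞^Θ_v) → Aut(𝒟^Θ_v)` and their one-object kind functors, BINDER-FREE AT THE GENUINE PLACE

S. Mochizuki, *Inter-universal Teichmüller theory I*, kurims manuscript (May 2020), §0 p. 33 ("isomorphism of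
categories" = isomorphism class of equivalences), Example 3.3 (i)–(ii) pp. 78–79 ("`p_v`-adic Frobenioids
`𝒞⊢_v ⊆ 𝒞_v` … whose base categories are given by `𝒟⊢_v`, `𝒟_v`"; "some `p_v`-adic Frobenioid `𝒞^Θ_v` with base category `𝒟^Θ_v = 𝒟⊢_v`"),
Example 3.3 (iii) p. 79: *"(b) the category `𝒟⊢_v` (respectively, `𝒟^Θ_v`) may be reconstructed category-theoretically
from `𝒞⊢_v` (respectively, `𝒞^Θ_v`) [cf. [FrdI], Theorem 3.4, (v); [FrdII], Theorem 1.2, (i); [FrdII], Example 1.3,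
(i); [AbsAnab], Theorem 1.1.1, (ii)]"*; Corollary 5.3 (iv) p. 144 l. 22–23 (*"the natural homomorphism
`Aut(ℱ̲_v) → Aut(𝒟_v)`"*, print's phrase at `v ∈ 𝕍^bad` — the MODEL for our §0 reading of (b) below as an induced
homomorphism `Aut(𝒞⊢_v) → Aut(𝒟⊢_v)`, which is OURS, not a phrase of Example 3.3); Corollary 3.7 (ii) (the passage
`ℱ⊢_v ↦ 𝒟⊢_v` of a Θ-Hodge theater)
([IUTchI] Ex 3.3 (iii) p.79) [claim: Mochizuki2012, status: disputed] (D-0012 claim key, status DISPUTED — nothing of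
the series is asserted; no side is taken on [IUTchIII] Cor. 3.12).  The mathematics is [FrdI] Cor. 4.11 (ii)
[cite: MochizukiFrdI2008, Cor. 4.11 p.91] at abc-iut-L1-t4's [FrdII] Ex. 1.1 kit Frobenioid `𝒞⊢_v` of
`Φ_{C⊢_v} = ℕ·ord(p_v)` over the REAL coset base `𝓑(G_v)⁰`.

WHY.  abc-iut-L5-t2 typed clause (b) as `GoodLocalFrobenioid.BasesFromC` (for every self-equivalence of `𝒞⊢_v`, SOME
self-equivalence of `𝒟⊢_v` under it — existence only), and this seat discharged it unconditionally at every actual good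
place (`GoodLocalFrobenioidOfPlaceSlim.lean`).  The slot `base v : Dash v ⥤ Base v` (`ℱ⊢_v ↦ 𝒟⊢_v`) of
abc-iut-L5-t2's `HodgeTheaterModel` in design F1 of the «genuine ℱ-prime-strip kit» hub (kinds := `SingleObj (CatAut −)`,
abc-iut-L5-t4) needs the passage as a FUNCTOR of one-object kinds, i.e. abc-iut-L5-t4's `CatIsomorphism.kindFunctor`
under the binders `HasUnder CdashBase CdashBase` / `UnderUnique CdashBase CdashBase`.  abc-iut-w4-d109's
`hasUnder_base_cosetCat` / `underUnique_base_cosetCat` (`GoodLocalFrobenioidOfGaloisCatIsomorphism.lean`) discharge these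
binders for ANY `p`-adic Frobenioid datum over a slim REAL coset base; `𝒞⊢_v` of abc-iut-L5-t2's `ofGalois` IS such a
datum (`PadicFrd.Datum.prim` of the field functor of `Ω/K_v` over `CosetCat G_v`, by `rfl`), and `G_v` slim is the
tree's [AbsAnab] Thm. 1.1.1 (ii) (`galoisMLF_slim_holds`, `isSlimGroup_gal_ofComplete`).  Hence (seat abc-iut-w4-d047
gen 9; hub row R44 «E33III-ON-ISOS» FILE 3):

* §1 at `ofGalois`: `hasUnder_cdashBase_ofGalois` / `underUnique_cdashBase_ofGalois` (and the `𝒞^Θ_v` twins) modulo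
  `IsSlim (CosetCat G_v)`, `…_of_isSlimGroup` in the printed group form;
* §2 at the PRINTED OBJECT `goodLocalFrobenioidOfEmb` and AT THE FINITE PLACE `v̲ = w ∣ p` (`goodLocalFrobenioidAt`):
  the same with NO HYPOTHESIS beyond the datum's openness `hX` (Def. 3.1 (f)) that builds the object, and the kind
  functors `InitialThetaData.cdashBaseKindFunctorAt` / `cthetaBaseKindFunctorAt :
  SingleObj (CatAut 𝒞⊢_v̲) ⥤ SingleObj (CatAut 𝒟⊢_v̲)` — our §0 reading of (b) (the induced homomorphism
  `Aut(𝒞⊢_v) → Aut(𝒟⊢_v)`) as a functor, binder-free.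

(Doc-only revision: referee finding M26-F2 — quotation marks now enclose verbatim print only and the `Aut`-homomorphism
reading is marked as ours; statements and proofs are byte-identical to the first landing.)

0 new `Prop` fact, 0 instance, 0 notation, nothing of the landed files restated; typed ≠ inhabited ≠ proved; a kind
functor on isomorphism CLASSES is OUR §0 reading of "reconstructed category-theoretically".
-/

noncomputable section

namespace Literature.IUT.HodgeTheaters

open CategoryTheory Literature.AnabelianGeometry.SemiGraphs Literature.AlgebraicGeometry.Frobenioids
open Literature.AlgebraicGeometry.Frobenioids.PadicFrd Literature.AnabelianGeometry.AbsoluteAnabelian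
open Literature.NumberTheory.NumberFields IsDedekindDomain NumberField

universe u

namespace GoodLocalFrobenioid

/-! ### §1. At `ofGalois`: `𝒞⊢_v ↦ 𝒟⊢_v = 𝓑(G_v)⁰` on isomorphisms of categories -/

section OfGalois

variable {p : ℕ} [Fact p.Prime] (d : GaloisValDatum.{u} p) {P : Type u} [Group P] [TopologicalSpace P]
  (aug : P →* d.Gal) (hc : Continuous aug) (hs : Function.Surjective aug) (ho : IsOpenMap aug)
  (Kv : Type) [Field Kv] [ValuativeRel Kv] (hp : ((p : Kv)) ∈ PadicFrd.intNonzero Kv)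

/-- **`HasUnder CdashBase CdashBase` at `ofGalois`**: under every self-equivalence of `𝒞⊢_v` lies an equivalence of
`𝒟⊢_v = 𝓑(G_v)⁰`, as soon as the coset category of `G_v` is slim ([FrdI] Cor. 4.11 (ii) at abc-iut-L1-t4's prime
datum; abc-iut-w4-d109's `hasUnder_base_cosetCat`). ([IUTchI] Ex 3.3 (iii) (b) p.79) [claim: Mochizuki2012, status: disputed] -/
theorem hasUnder_cdashBase_ofGalois [IsTopologicalGroup d.Gal] (hsl : IsSlim (CosetCat d.Gal)) :
    CatIsomorphism.HasUnder (ofGalois d aug hc hs ho Kv hp).CdashBase (ofGalois d aug hc hs ho Kv hp).CdashBase :=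
  hasUnder_base_cosetCat _ _ hsl hsl

/-- **`UnderUnique CdashBase CdashBase` at `ofGalois`**: the equivalence of `𝒟⊢_v` lying under a self-equivalence of
`𝒞⊢_v` is unique up to isomorphism (abc-iut-w4-d109's `underUnique_base_cosetCat`).
([IUTchI] Ex 3.3 (iii) (b) p.79) [claim: Mochizuki2012, status: disputed] -/
theorem underUnique_cdashBase_ofGalois [IsTopologicalGroup d.Gal] (hsl : IsSlim (CosetCat d.Gal)) :
    CatIsomorphism.UnderUnique (ofGalois d aug hc hs ho Kv hp).CdashBase (ofGalois d aug hc hs ho Kv hp).CdashBase :=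
  underUnique_base_cosetCat _ _ hsl hsl

/-- **`HasUnder CThetaBase CThetaBase` at `ofGalois`** ("respectively, `𝒟^Θ_v` … from `𝒞^Θ_v`"; at `ofKit` the
Θ-side is the same kit Frobenioid with the relabelled generator). ([IUTchI] Ex 3.3 (iii) (b) p.79) [claim: Mochizuki2012, status: disputed] -/
theorem hasUnder_cthetaBase_ofGalois [IsTopologicalGroup d.Gal] (hsl : IsSlim (CosetCat d.Gal)) :
    CatIsomorphism.HasUnder (ofGalois d aug hc hs ho Kv hp).CThetaBase (ofGalois d aug hc hs ho Kv hp).CThetaBase :=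
  hasUnder_base_cosetCat _ _ hsl hsl

/-- **`UnderUnique CThetaBase CThetaBase` at `ofGalois`.** ([IUTchI] Ex 3.3 (iii) (b) p.79) [claim: Mochizuki2012, status: disputed] -/
theorem underUnique_cthetaBase_ofGalois [IsTopologicalGroup d.Gal] (hsl : IsSlim (CosetCat d.Gal)) :
    CatIsomorphism.UnderUnique (ofGalois d aug hc hs ho Kv hp).CThetaBase (ofGalois d aug hc hs ho Kv hp).CThetaBase :=
  underUnique_base_cosetCat _ _ hsl hsl

/-- **Group form** (print's citation "[AbsAnab], Theorem 1.1.1, (ii)": `G_v` slim): for slim profinite `G_v` both binders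
of the induced homomorphism `Aut(𝒞⊢_v) → Aut(𝒟⊢_v)` (our §0 reading) hold at `ofGalois` (abc-iut-L1-t4's `PadicFrd.isSlim_cosetCat_of_isSlimGroup`).
([IUTchI] Ex 3.3 (iii) (b) p.79) [claim: Mochizuki2012, status: disputed] -/
theorem hasUnder_and_underUnique_cdashBase_ofGalois_of_isSlimGroup [IsTopologicalGroup d.Gal] [CompactSpace d.Gal]
    [TotallyDisconnectedSpace d.Gal] (hZ : IsSlimGroup d.Gal) :
    CatIsomorphism.HasUnder (ofGalois d aug hc hs ho Kv hp).CdashBase (ofGalois d aug hc hs ho Kv hp).CdashBase ∧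
      CatIsomorphism.UnderUnique (ofGalois d aug hc hs ho Kv hp).CdashBase (ofGalois d aug hc hs ho Kv hp).CdashBase :=
  ⟨hasUnder_cdashBase_ofGalois d aug hc hs ho Kv hp (PadicFrd.isSlim_cosetCat_of_isSlimGroup hZ),
    underUnique_cdashBase_ofGalois d aug hc hs ho Kv hp (PadicFrd.isSlim_cosetCat_of_isSlimGroup hZ)⟩

/-- **The passage `𝒞⊢_v ↦ 𝒟⊢_v` as a functor of one-object kinds at `ofGalois`** (abc-iut-L5-t4's `kindFunctor` of
the induced homomorphism, our §0 reading), modulo the slimness of `𝓑(G_v)⁰`. ([IUTchI] Ex 3.3 (iii) (b) p.79) [claim: Mochizuki2012, status: disputed] -/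
def cdashBaseKindFunctorOfGalois [IsTopologicalGroup d.Gal] (hsl : IsSlim (CosetCat d.Gal)) :
    SingleObj (CatAut (ofGalois d aug hc hs ho Kv hp).Cdash) ⥤ SingleObj (CatAut (ofGalois d aug hc hs ho Kv hp).Ddash) :=
  CatIsomorphism.kindFunctor (hasUnder_cdashBase_ofGalois d aug hc hs ho Kv hp hsl)
    (underUnique_cdashBase_ofGalois d aug hc hs ho Kv hp hsl)

end OfGalois

end GoodLocalFrobenioid

/-! ### §2. At the printed object `goodLocalFrobenioidOfEmb` and AT THE FINITE PLACE `v̲ = w ∣ p`: binder-free -/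

section Datum

variable {F : Type u} {K : Type} {Fbar : Type} [Field F] [NumberField F] [Field K] [NumberField K]
  [Algebra F K] [Field Fbar] [Algebra F Fbar] [Algebra K Fbar] [IsScalarTower F K Fbar] [Normal K Fbar]
  {E : WeierstrassCurve F} [E.IsElliptic] {l : ℕ} {Pb : BadPlacePredicates K}
  (D : InitialThetaData F K Fbar E l Pb) (p : ℕ) [Fact p.Prime]
  (k : Type) [NontriviallyNormedField k] [CompleteSpace k] [IsUltrametricDist k] [NormedAlgebra ℚ_[p] k]
  [FiniteDimensional ℚ_[p] k] [Algebra K k]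

namespace InitialThetaData

/-- **Both binders of `Aut(𝒞⊢_v̲) → Aut(𝒟⊢_v̲)` AT THE PRINTED OBJECT** `goodLocalFrobenioidOfEmb` (`K_v̲ = k`,
`G_v̲ = Gal(k̄/k)`), with NO hypothesis beyond the datum's openness `hX`: `G_v̲` slim is the tree's [AbsAnab] Thm. 1.1.1
(ii) (`GoodLocalFrobenioid.isSlimGroup_gal_ofComplete`). ([IUTchI] Ex 3.3 (iii) (b) p.79) [claim: Mochizuki2012, status: disputed] -/
theorem hasUnder_and_underUnique_cdashBase_goodLocalFrobenioidOfEmb (ι : Fbar →ₐ[K] AlgebraicClosure k)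
    (hX : IsOpen (D.PiXarrow : Set D.PiC)) :
    CatIsomorphism.HasUnder
        (@GoodLocalFrobenioid.CdashBase p k _ (GaloisValDatum.normVal k) (D.goodLocalFrobenioidOfEmb p k ι hX))
        (@GoodLocalFrobenioid.CdashBase p k _ (GaloisValDatum.normVal k) (D.goodLocalFrobenioidOfEmb p k ι hX)) ∧
      CatIsomorphism.UnderUnique
        (@GoodLocalFrobenioid.CdashBase p k _ (GaloisValDatum.normVal k) (D.goodLocalFrobenioidOfEmb p k ι hX))
        (@GoodLocalFrobenioid.CdashBase p k _ (GaloisValDatum.normVal k) (D.goodLocalFrobenioidOfEmb p k ι hX)) := by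
  letI := GaloisValDatum.normVal k
  exact GoodLocalFrobenioid.hasUnder_and_underUnique_cdashBase_ofGalois_of_isSlimGroup (GaloisValDatum.ofComplete p k)
    _ _ _ _ k (GaloisValDatum.p_mem_normVal p k) (GoodLocalFrobenioid.isSlimGroup_gal_ofComplete p k)

end InitialThetaData

end Datum

section Place

variable {F : Type u} {K : Type} {Fbar : Type} [Field F] [NumberField F] [Field K] [NumberField K]
  [Algebra F K] [Field Fbar] [Algebra F Fbar] [Algebra K Fbar] [IsScalarTower F K Fbar] [Normal K Fbar]
  {E : WeierstrassCurve F} [E.IsElliptic] {l : ℕ} {Pb : BadPlacePredicates K}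
  (D : InitialThetaData F K Fbar E l Pb) (w : HeightOneSpectrum (𝓞 K)) (p : ℕ) [Fact p.Prime]
  (hw : ((p : ℕ) : 𝓞 K) ∈ w.asIdeal)

namespace InitialThetaData

/-- **Both binders of `Aut(𝒞⊢_v̲) → Aut(𝒟⊢_v̲)` AT THE FINITE PLACE `v̲ = w ∣ p`** (`goodLocalFrobenioidAt`,
`K_v̲ := K_w`), NO hypothesis beyond `hX`. ([IUTchI] Ex 3.3 (iii) (b) p.79) [claim: Mochizuki2012, status: disputed] -/
theorem hasUnder_and_underUnique_cdashBase_goodLocalFrobenioidAt (hX : IsOpen (D.PiXarrow : Set D.PiC)) :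
    CatIsomorphism.HasUnder
        (@GoodLocalFrobenioid.CdashBase p (RescaledCompletion K p w hw) _
          (GaloisValDatum.normVal (RescaledCompletion K p w hw)) (D.goodLocalFrobenioidAt w p hw hX))
        (@GoodLocalFrobenioid.CdashBase p (RescaledCompletion K p w hw) _
          (GaloisValDatum.normVal (RescaledCompletion K p w hw)) (D.goodLocalFrobenioidAt w p hw hX)) ∧
      CatIsomorphism.UnderUnique
        (@GoodLocalFrobenioid.CdashBase p (RescaledCompletion K p w hw) _
          (GaloisValDatum.normVal (RescaledCompletion K p w hw)) (D.goodLocalFrobenioidAt w p hw hX))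
        (@GoodLocalFrobenioid.CdashBase p (RescaledCompletion K p w hw) _
          (GaloisValDatum.normVal (RescaledCompletion K p w hw)) (D.goodLocalFrobenioidAt w p hw hX)) := by
  letI : Algebra K (RescaledCompletion K p w hw) := inferInstanceAs (Algebra K (w.adicCompletion K))
  haveI := GaloisValDatum.finiteDimensional_rescaledCompletion K p w hw
  exact D.hasUnder_and_underUnique_cdashBase_goodLocalFrobenioidOfEmb p (RescaledCompletion K p w hw)
    (localEmb (K := K) (Fbar := Fbar) (AlgebraicClosure (RescaledCompletion K p w hw))) hX

/-- **[IUTchI] Ex. 3.3 (iii) (b) AS A KIND FUNCTOR AT THE PLACE `v̲ = w ∣ p`, BINDER-FREE**: `𝒞⊢_v̲ ↦ 𝒟⊢_v̲ = 𝓑(G_v̲)⁰`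
on one-object kinds — our §0 reading: the induced homomorphism `Aut(𝒞⊢_v) → Aut(𝒟⊢_v)` (the slot `base v` of abc-iut-L5-t2's
`HodgeTheaterModel` in design F1) for the genuine datum `goodLocalFrobenioidAt`, from abc-iut-L5-t4's `kindFunctor` and
the two binders discharged above. ([IUTchI] Ex 3.3 (iii) (b) p.79) [claim: Mochizuki2012, status: disputed] -/
def cdashBaseKindFunctorAt (hX : IsOpen (D.PiXarrow : Set D.PiC)) :
    SingleObj (CatAut (@GoodLocalFrobenioid.Cdash p (RescaledCompletion K p w hw) _
        (GaloisValDatum.normVal (RescaledCompletion K p w hw)) (D.goodLocalFrobenioidAt w p hw hX))) ⥤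
      SingleObj (CatAut (@GoodLocalFrobenioid.Ddash p (RescaledCompletion K p w hw) _
        (GaloisValDatum.normVal (RescaledCompletion K p w hw)) (D.goodLocalFrobenioidAt w p hw hX))) :=
  CatIsomorphism.kindFunctor (D.hasUnder_and_underUnique_cdashBase_goodLocalFrobenioidAt w p hw hX).1
    (D.hasUnder_and_underUnique_cdashBase_goodLocalFrobenioidAt w p hw hX).2

/-- **The `𝒞^Θ_v̲ ↦ 𝒟^Θ_v̲` twin AT THE PLACE, BINDER-FREE** ("respectively, `𝒟^Θ_v` … from `𝒞^Θ_v`"; the Θ-side of the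
genuine datum is the same kit Frobenioid over `𝒟^Θ_v̲ := 𝒟⊢_v̲` with the relabelled generator, so the same binders
serve). ([IUTchI] Ex 3.3 (iii) (b) p.79) [claim: Mochizuki2012, status: disputed] -/
def cthetaBaseKindFunctorAt (hX : IsOpen (D.PiXarrow : Set D.PiC)) :
    SingleObj (CatAut (@GoodLocalFrobenioid.CTheta p (RescaledCompletion K p w hw) _
        (GaloisValDatum.normVal (RescaledCompletion K p w hw)) (D.goodLocalFrobenioidAt w p hw hX))) ⥤
      SingleObj (CatAut (@GoodLocalFrobenioid.Ddash p (RescaledCompletion K p w hw) _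
        (GaloisValDatum.normVal (RescaledCompletion K p w hw)) (D.goodLocalFrobenioidAt w p hw hX))) :=
  CatIsomorphism.kindFunctor (D.hasUnder_and_underUnique_cdashBase_goodLocalFrobenioidAt w p hw hX).1
    (D.hasUnder_and_underUnique_cdashBase_goodLocalFrobenioidAt w p hw hX).2

/-- On endomorphisms of the unique object `cdashBaseKindFunctorAt` is abc-iut-L5-t4's `descend` (the class of the
essentially unique equivalence of `𝒟⊢_v̲` lying under a given self-equivalence of `𝒞⊢_v̲`).
([IUTchI] Ex 3.3 (iii) (b) p.79) [claim: Mochizuki2012, status: disputed] -/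
theorem cdashBaseKindFunctorAt_map (hX : IsOpen (D.PiXarrow : Set D.PiC))
    (a : SingleObj.star (CatAut (@GoodLocalFrobenioid.Cdash p (RescaledCompletion K p w hw) _
        (GaloisValDatum.normVal (RescaledCompletion K p w hw)) (D.goodLocalFrobenioidAt w p hw hX))) ⟶
      SingleObj.star (CatAut (@GoodLocalFrobenioid.Cdash p (RescaledCompletion K p w hw) _
        (GaloisValDatum.normVal (RescaledCompletion K p w hw)) (D.goodLocalFrobenioidAt w p hw hX)))) :
    (D.cdashBaseKindFunctorAt w p hw hX).map a =
      CatIsomorphism.descend (D.hasUnder_and_underUnique_cdashBase_goodLocalFrobenioidAt w p hw hX).1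
        (D.hasUnder_and_underUnique_cdashBase_goodLocalFrobenioidAt w p hw hX).2 a := rfl

end InitialThetaData

end Place

end Literature.IUT.HodgeTheaters

end
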